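import Summits.AtomisticToContinuum.Crystallization.Theorems.LoopTunnelDialRangeTails

/-!
# LoopTunnelDial — the INTEGER-SHELL tail `τₙ` (kit 7b) (lens-5 g19 range dial; crux `PocketCase`, stmt-AtomisticToContinuum-27294)

Kit file 7b (imports 7a).  The dyadic constant `432·(10/7)³·R⁻³` of the tree is replaced, at integer range `n ≥ 2`, by the INTEGER-SHELL count
`τₙ = ((20 + 27/n)/7)³ / (2n(n−1))`: the far particles of a `7/10`-separated configuration are sorted into shells `j < r ≤ j+1` (`⌈r⌉ = j+1`, `j ≥ n`),
each holding `≤ (2(j+1)/(7/10) + 1)³ ≤ ((20 + 27/n)/7)³·j³` points of weight `≤ j⁻⁶`, and `∑_{j ≥ n} j⁻³ ≤ 1/(2n(n−1))` by the telescoping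
`(t+1)⁻³ ≤ 1/(2t(t+1)) − 1/(2(t+1)(t+2))`.  Results: `invSixTail_shells : InvSixTail n (tauShell n)`, `farTails_shells`, and the numerals
`τ₅ < 6/5`, `τ₈ < 17/50`, `τ₄ < 233/100` (dyadic at the same ranges: `10.1`, `2.46`, `19.7`).

Every `def` below is line vocabulary of the LoopTunnelDial contact dial (crux stmt-AtomisticToContinuum-27294), not a cited fact.  0 sorry.
-/

noncomputable section

namespace Summit.AtomisticToContinuum.Crystallization.Theorems.LoopTunnelDialShellTail

open scoped BigOperators Classical InnerProductSpace
open Literature.MathematicalPhysics.StatisticalMechanics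
open Literature.MathematicalPhysics.StatisticalMechanics.Yuhjtman2015 (hLJ)
open Summit.AtomisticToContinuum.Crystallization.Theorems.GrainPercolationDialCrossCeiling (E3 ballChunk)
open Summit.AtomisticToContinuum.Crystallization.Theorems.ChargedEnergyGapNegative (eStar)
open Summit.AtomisticToContinuum.Crystallization.Theorems.OverbindingBudgetCubeTails (sum_inv_pow_six_le_dyadic)
open Summit.AtomisticToContinuum.Crystallization.Theorems.LoopTunnelDialContactLaw
open Summit.AtomisticToContinuum.Crystallization.Theorems.LoopTunnelDialRangeTails

variable {N : ℕ}

/-- `tauShell n = ((20 + 27/n)/7)³ / (2n(n−1))` — the certified bound on `∑_{r > n} r⁻⁶` over a `7/10`-separated set (`n ≥ 2`). -/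
def tauShell (n : ℕ) : ℝ := ((20 + 27 / (n : ℝ)) / 7) ^ 3 / (2 * (n : ℝ) * ((n : ℝ) - 1))

/-- The integer-shell tail constant is nonnegative for `n ≥ 2`. -/
theorem tauShell_nonneg {n : ℕ} (hn : 2 ≤ n) : 0 ≤ tauShell n := by
  have hn' : (2 : ℝ) ≤ n := by exact_mod_cast hn
  unfold tauShell
  apply div_nonneg (by positivity)
  nlinarith

/-- One telescoping step: `(t+1)⁻³ ≤ 1/(2t(t+1)) − 1/(2(t+1)(t+2))` for `t ≥ 1`. -/
theorem inv_cube_succ_le_telescope {t : ℝ} (ht : 1 ≤ t) :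
    (t + 1)⁻¹ ^ 3 ≤ 1 / (2 * t * (t + 1)) - 1 / (2 * (t + 1) * (t + 2)) := by
  have ht0 : 0 < t := by linarith
  have h1 : 1 / (2 * t * (t + 1)) - 1 / (2 * (t + 1) * (t + 2)) = 1 / (t * (t + 1) * (t + 2)) := by
    field_simp
    ring
  rw [h1, inv_pow, ← one_div]
  apply one_div_le_one_div_of_le (by positivity)
  nlinarith

/-- **Telescoping (PROVED):** `∑_{j = n}^{K} j⁻³ ≤ 1/(2n(n−1))` for `n ≥ 2`. -/
theorem sum_Icc_inv_cube_le {n : ℕ} (hn : 2 ≤ n) (K : ℕ) :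
    ∑ j ∈ Finset.Icc n K, ((j : ℝ))⁻¹ ^ 3 ≤ 1 / (2 * (n : ℝ) * ((n : ℝ) - 1)) := by
  have hn' : (2 : ℝ) ≤ n := by exact_mod_cast hn
  -- the sharper statement with the telescoping remainder, for `K ≥ n`
  have key : ∀ K : ℕ, n ≤ K →
      ∑ j ∈ Finset.Icc n K, ((j : ℝ))⁻¹ ^ 3 ≤ 1 / (2 * ((n : ℝ) - 1) * n) - 1 / (2 * (K : ℝ) * ((K : ℝ) + 1)) := by
    intro K hK
    induction K with
    | zero => omega
    | succ K ih =>
      rcases Nat.eq_or_lt_of_le hK with h | h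
      · -- base: K + 1 = n
        rw [← h, Finset.Icc_self, Finset.sum_singleton]
        have := inv_cube_succ_le_telescope (t := (n : ℝ) - 1) (by linarith)
        have e1 : ((n : ℝ) - 1 + 1) = n := by ring
        have e2 : ((n : ℝ) - 1 + 2) = n + 1 := by ring
        rw [e1, e2] at this
        linarith
      · have hK' : n ≤ K := Nat.lt_succ_iff.1 h
        rw [Finset.sum_Icc_succ_top (by omega)]
        have h1 := ih hK'
        have hK1 : (1 : ℝ) ≤ K := by
          have : (n : ℝ) ≤ K := by exact_mod_cast hK'
          linarith
        have h2 := inv_cube_succ_le_telescope hK1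
        push_cast
        have e2 : ((K : ℝ) + 1 + 1) = K + 2 := by ring
        rw [e2]
        linarith
  by_cases hK : n ≤ K
  · have h := key K hK
    have hKpos : 0 < 1 / (2 * (K : ℝ) * ((K : ℝ) + 1)) := by
      have : (2 : ℝ) ≤ K := le_trans hn' (by exact_mod_cast hK)
      positivity
    have e : 1 / (2 * ((n : ℝ) - 1) * n) = 1 / (2 * (n : ℝ) * ((n : ℝ) - 1)) := by ring
    linarith
  · rw [Finset.Icc_eq_empty_of_lt (not_le.1 hK), Finset.sum_empty]
    have : 0 < 2 * (n : ℝ) * ((n : ℝ) - 1) := by nlinarith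
    positivity

/-- One integer shell: the particles `m ≠ k` with `⌈r_{km}⌉ = j + 1`, all at distance `≤ j + 1`, number at most `(20(j+1)/7 + 1)³` and each
contributes `≤ j⁻⁶`; and `(20(j+1)/7+1)³ j⁻⁶ ≤ ((20 + 27/n)/7)³ j⁻³` for `j ≥ n`. -/
theorem shell_sum_le {y : Fin N → E3} (hy : Function.Injective y)
    (hsep : ∀ i j : Fin N, i ≠ j → (7 : ℝ) / 10 ≤ dist (y i) (y j)) (k : Fin N) {n : ℕ} (hn : 2 ≤ n) {j : ℕ} (hj : n ≤ j) :
    ∑ m ∈ (farIdx (n : ℝ) y k).filter (fun m => ⌈dist (y k) (y m)⌉₊ - 1 = j), (dist (y k) (y m))⁻¹ ^ 6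
      ≤ ((20 + 27 / (n : ℝ)) / 7) ^ 3 * ((j : ℝ))⁻¹ ^ 3 := by
  set S := (farIdx (n : ℝ) y k).filter (fun m => ⌈dist (y k) (y m)⌉₊ - 1 = j) with hS
  have hn' : (2 : ℝ) ≤ n := by exact_mod_cast hn
  have hj' : (n : ℝ) ≤ j := by exact_mod_cast hj
  have hj0 : (0 : ℝ) < j := by linarith
  -- membership facts
  have hmem : ∀ m ∈ S, (j : ℝ) < dist (y k) (y m) ∧ dist (y k) (y m) ≤ (j : ℝ) + 1 := by
    intro m hm
    obtain ⟨hfar, hceil⟩ := Finset.mem_filter.1 hm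
    have hfar' : (n : ℝ) < dist (y k) (y m) := not_le.1 (Finset.mem_filter.1 hfar).2
    have hc1 : n < ⌈dist (y k) (y m)⌉₊ := Nat.lt_ceil.2 hfar'
    have hcj : ⌈dist (y k) (y m)⌉₊ = j + 1 := by omega
    constructor
    · have : j < ⌈dist (y k) (y m)⌉₊ := by omega
      exact_mod_cast Nat.lt_ceil.1 this
    · have : ⌈dist (y k) (y m)⌉₊ ≤ j + 1 := hcj.le
      exact_mod_cast Nat.ceil_le.1 this
  -- each term ≤ j⁻⁶
  have hterm : ∀ m ∈ S, (dist (y k) (y m))⁻¹ ^ 6 ≤ ((j : ℝ))⁻¹ ^ 6 := by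
    intro m hm
    have h := (hmem m hm).1
    exact pow_le_pow_left₀ (inv_nonneg.2 (by linarith)) (inv_anti₀ hj0 h.le) 6
  -- the count
  have hcard : (S.card : ℝ) ≤ (2 * ((j : ℝ) + 1) / (7 / 10) + 1) ^ 3 := by
    have h := card_le_of_finRange (s := S.image y) (x := y k) (R := (j : ℝ) + 1) (by linarith)
      (fun z hz => by
        obtain ⟨m, hm, rfl⟩ := Finset.mem_image.1 hz
        exact (hmem m hm).2)
      (fun z hz w hw hzw => by
        obtain ⟨m, hm, rfl⟩ := Finset.mem_image.1 hz
        obtain ⟨m', hm', rfl⟩ := Finset.mem_image.1 hw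
        exact hsep m m' (fun hh => hzw (congrArg y hh)))
    rwa [Finset.card_image_of_injective S hy] at h
  -- the envelope
  have henv : (2 * ((j : ℝ) + 1) / (7 / 10) + 1) ≤ (20 + 27 / (n : ℝ)) / 7 * j := by
    have e : (2 * ((j : ℝ) + 1) / (7 / 10) + 1) = (20 * j + 27) / 7 := by ring
    rw [e]
    have h27 : (27 : ℝ) ≤ 27 / (n : ℝ) * j := by
      rw [div_mul_eq_mul_div, le_div_iff₀ (by linarith)]
      nlinarith
    have e2 : (20 + 27 / (n : ℝ)) / 7 * j = (20 * j + 27 / (n : ℝ) * j) / 7 := by ring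
    rw [e2]
    gcongr
  have henv0 : 0 ≤ (2 * ((j : ℝ) + 1) / (7 / 10) + 1) := by positivity
  have henv3 := pow_le_pow_left₀ henv0 henv 3
  calc ∑ m ∈ S, (dist (y k) (y m))⁻¹ ^ 6 ≤ ∑ m ∈ S, ((j : ℝ))⁻¹ ^ 6 := Finset.sum_le_sum hterm
    _ = S.card * ((j : ℝ))⁻¹ ^ 6 := by rw [Finset.sum_const, nsmul_eq_mul]
    _ ≤ (2 * ((j : ℝ) + 1) / (7 / 10) + 1) ^ 3 * ((j : ℝ))⁻¹ ^ 6 := by gcongr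
    _ ≤ ((20 + 27 / (n : ℝ)) / 7 * j) ^ 3 * ((j : ℝ))⁻¹ ^ 6 := by gcongr
    _ = ((20 + 27 / (n : ℝ)) / 7) ^ 3 * ((j : ℝ))⁻¹ ^ 3 := by
        have hj1 : (j : ℝ) ≠ 0 := hj0.ne'
        field_simp

/-- **THE INTEGER-SHELL TAIL (PROVED):** `∑_{m : r_{km} > n} r_{km}⁻⁶ ≤ τₙ` in every injective `7/10`-separated configuration, `n ≥ 2`. -/
theorem invSixTail_shells {n : ℕ} (hn : 2 ≤ n) : InvSixTail (n : ℝ) (tauShell n) := by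
  intro N y hy hsep k
  have hn' : (2 : ℝ) ≤ n := by exact_mod_cast hn
  -- a crude bound on all distances: each is ≤ the sum of all
  set K : ℕ := ⌈∑ m : Fin N, dist (y k) (y m)⌉₊ with hK
  have hdistK : ∀ m : Fin N, dist (y k) (y m) ≤ (K : ℝ) + 1 := by
    intro m
    have h1 : dist (y k) (y m) ≤ ∑ m' : Fin N, dist (y k) (y m') :=
      Finset.single_le_sum (f := fun m' => dist (y k) (y m')) (fun _ _ => dist_nonneg) (Finset.mem_univ m)
    have h2 := Nat.le_ceil (∑ m' : Fin N, dist (y k) (y m'))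
    linarith
  -- fibre over the shell index
  have hmaps : ∀ m ∈ farIdx (n : ℝ) y k, ⌈dist (y k) (y m)⌉₊ - 1 ∈ Finset.Icc n K := by
    intro m hm
    have hfar : (n : ℝ) < dist (y k) (y m) := not_le.1 (Finset.mem_filter.1 hm).2
    have h1 : n < ⌈dist (y k) (y m)⌉₊ := Nat.lt_ceil.2 hfar
    have h2 : ⌈dist (y k) (y m)⌉₊ ≤ K + 1 := Nat.ceil_le.2 (by exact_mod_cast hdistK m)
    rw [Finset.mem_Icc]
    omega
  rw [← Finset.sum_fiberwise_of_maps_to hmaps]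
  calc ∑ j ∈ Finset.Icc n K, ∑ m ∈ (farIdx (n : ℝ) y k).filter (fun m => ⌈dist (y k) (y m)⌉₊ - 1 = j), (dist (y k) (y m))⁻¹ ^ 6
      ≤ ∑ j ∈ Finset.Icc n K, ((20 + 27 / (n : ℝ)) / 7) ^ 3 * ((j : ℝ))⁻¹ ^ 3 :=
        Finset.sum_le_sum (fun j hj => shell_sum_le hy hsep k hn (Finset.mem_Icc.1 hj).1)
    _ = ((20 + 27 / (n : ℝ)) / 7) ^ 3 * ∑ j ∈ Finset.Icc n K, ((j : ℝ))⁻¹ ^ 3 := (Finset.mul_sum _ _ _).symm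
    _ ≤ ((20 + 27 / (n : ℝ)) / 7) ^ 3 * (1 / (2 * (n : ℝ) * ((n : ℝ) - 1))) := by
        gcongr
        exact sum_Icc_inv_cube_le hn K
    _ = tauShell n := by unfold tauShell; ring

/-- The integer-shell FAR TAILS: `FarTails n (τₙ/6) ((n⁻¹ + n⁻⁷)·τₙ)` for `n ≥ 2`. -/
theorem farTails_shells {n : ℕ} (hn : 2 ≤ n) :
    FarTails (n : ℝ) (1 / 6 * tauShell n) ((((n : ℝ))⁻¹ + ((n : ℝ))⁻¹ ^ 7) * tauShell n) :=
  farTails_of_invSixTail (by have : (2 : ℝ) ≤ n := (by exact_mod_cast hn); linarith) (invSixTail_shells hn)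

/-- `τ₅ < 1.2`. -/
theorem tauShell_five_lt : tauShell 5 < 6 / 5 := by unfold tauShell; norm_num
/-- `τ₈ < 0.34`. -/
theorem tauShell_eight_lt : tauShell 8 < 17 / 50 := by unfold tauShell; norm_num
/-- `τ₄ < 2.33`. -/
theorem tauShell_four_lt : tauShell 4 < 233 / 100 := by unfold tauShell; norm_num

end Summit.AtomisticToContinuum.Crystallization.Theorems.LoopTunnelDialShellTail
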